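import Summits.AtomisticToContinuum.BoseEinsteinCondensation.Theorems.BECGroundStateSOSPeriodicIRBoundFsumDefs
import Summits.AtomisticToContinuum.BoseEinsteinCondensation.Theorems.BECGroundStateSOSPeriodicIRBoundWFFormBounds
import Summits.AtomisticToContinuum.BoseEinsteinCondensation.Theorems.BECGroundStateSOSPeriodicIRBoundWFRegularity
import Summits.AtomisticToContinuum.BoseEinsteinCondensation.Theorems.BECGroundStateSOSPeriodicIRBoundWFHeartKin
import Literature.MathematicalPhysics.QuantumManyBody.CoarseModeRayPOVMFormCore
import HarnessLib

/-!
# Crux `PeriodicIRBound` (stmt-AtomisticToContinuum-3972), line `fsum-phase-pencil`, stub S3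
# `stub_phaseDoubleCommutator` — potential part, A: slot lifts of rank-one one-body operators

First-quantised vocabulary for the interaction double commutator `⟨[U_k†,[V,U_k]]⟩`:

* `slotLift L j a b F` — the rank-one one-body operator `|φ_a⟩⟨φ_b|` acting on particle `j` of an
  `N`-body function (`φ_c = planeWaveMode L c`): `X ↦ φ_a(x_j) ∫_cell conj(φ_b(y)) F(X[j ↦ y]) dy`;
* `liftOp L S a b c d F = ∑_{j ∈ S} (slotLift j a b F − slotLift j c d F)` — the lift of `|φ_a⟩⟨φ_b| − |φ_c⟩⟨φ_d|`
  to the particles of `S` (`S = univ`, `(a,b,c,d) = (k,0,0,−k)`: the phase quadrature `U_k` on Bose-symmetric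
  functions; `S = {0,1}ᶜ`: its part commuting with the pair weight `w^per(x_0 − x_1)`);
* `pairForm w L F G = ∫_{cell^{m+2}} w^per(x_0 − x_1) conj(F) G` — the sesquilinear form of ONE pair.

This file: continuity and linearity of the lifts, `[slotLift i, slotLift j] = 0` for `i ≠ j` (Fubini on
`cell × cell`), `transfer L a b Ψ = ∑_j slotLift j a b Ψ` for Bose-symmetric `Ψ`, and the pointwise smoothing
bound `|slotLift j a b F(X)|² ≤ L⁻³ ∫_cell |F(X[j ↦ y])|² dy` (Bessel). Registered by-product sub-goal
`stub_fsumDCPotSlot`.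
-/

noncomputable section

open MeasureTheory Filter
open scoped ENNReal NNReal ComplexConjugate BigOperators

namespace Summit.AtomisticToContinuum.BoseEinsteinCondensation.Cruxes.PeriodicIRBound.FsumPhasePencil

open Literature.MathematicalPhysics.QuantumManyBody.BoseGas
open Summit.AtomisticToContinuum.BoseEinsteinCondensation.Cruxes.PeriodicIRBound.LinearPhFloorWagner.WF

variable {N m n : ℕ} {L : ℝ}

/-! ## Definitions -/

/-- The **slot lift** of the rank-one one-body operator `|φ_a⟩⟨φ_b|` (`φ_c = planeWaveMode L c`) to particle `j`
of an `N`-body function: `(slotLift L j a b F)(X) = φ_a(x_j) ∫_cell conj(φ_b(y)) F(X[j ↦ y]) dy`. [folklore] -/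
def slotLift (L : ℝ) (j : Fin N) (a b : Fin 3 → ℤ) (F : Config N → ℂ) (X : Config N) : ℂ :=
  planeWaveMode L a (X j) * ∫ y in cell L, conj (planeWaveMode L b y) * F (Function.update X j y)

/-- The lift of the rank-two one-body operator `|φ_a⟩⟨φ_b| − |φ_c⟩⟨φ_d|` to the particles of `S`:
`∑_{j ∈ S} (slotLift j a b − slotLift j c d)`. [folklore] -/
def liftOp (L : ℝ) (S : Finset (Fin N)) (a b c d : Fin 3 → ℤ) (F : Config N → ℂ) (X : Config N) : ℂ :=
  ∑ j ∈ S, (slotLift L j a b F X - slotLift L j c d F X)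

/-- The **pair form** `∫_{cell^{m+2}} w^per(x_0 − x_1) conj(F(X)) G(X) dX` of the pair `(0, 1)`. [folklore] -/
def pairForm (w : ℝ → ℝ≥0∞) (L : ℝ) (F G : Config (m + 2) → ℂ) : ℂ :=
  ∫ X in cellN (m + 2) L, ((periodizedPotential w L (X 0 - X 1)).toReal : ℂ) * (conj (F X) * G X)

/-! ## The slot lift: continuity, linearity -/

section SlotLift

variable (L : ℝ) (j : Fin N) (a b : Fin 3 → ℤ)

/-- Unfolding `slotLift`. [folklore] -/
theorem slotLift_apply (F : Config N → ℂ) (X : Config N) :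
    slotLift L j a b F X = planeWaveMode L a (X j) * ∫ y in cell L, conj (planeWaveMode L b y) * F (Function.update X j y) :=
  rfl

variable {L j a b}

/-- The slices `y ↦ conj(φ_b(y)) F(X[j ↦ y])` of a continuous `F` are integrable on the cell. [folklore] -/
theorem integrableOn_slice_update (b : Fin 3 → ℤ) (j : Fin N) {F : Config N → ℂ} (hF : Continuous F) (X : Config N) :
    IntegrableOn (fun y => conj (planeWaveMode L b y) * F (Function.update X j y)) (cell L) volume :=
  integrableOn_cell ((Complex.continuous_conj.comp (continuous_planeWaveMode L b)).mul
    (hF.comp (continuous_const.update j continuous_id)))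

/-- `slotLift j a b F` is continuous for continuous `F` (a parametric integral over the bounded cell). [folklore] -/
theorem continuous_slotLift (L : ℝ) (j : Fin N) (a b : Fin 3 → ℤ) {F : Config N → ℂ} (hF : Continuous F) :
    Continuous (slotLift L j a b F) := by
  have hG : Continuous fun p : Space × Config N => conj (planeWaveMode L b p.1) * F (Function.update p.2 j p.1) :=
    (Complex.continuous_conj.comp ((continuous_planeWaveMode L b).comp continuous_fst)).mul
      (hF.comp (continuous_snd.update j continuous_fst))
  unfold slotLift
  exact ((continuous_planeWaveMode L a).comp (continuous_apply j)).mul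
    (continuous_parametric_setIntegral_of_isBounded (isBounded_cell L) (measurableSet_cell L) hG)

/-- Additivity of the slot lift (continuous arguments). [folklore] -/
theorem slotLift_add {F G : Config N → ℂ} (hF : Continuous F) (hG : Continuous G) :
    slotLift L j a b (fun X => F X + G X) = fun X => slotLift L j a b F X + slotLift L j a b G X := by
  funext X
  simp only [slotLift, mul_add]
  rw [integral_add (integrableOn_slice_update b j hF X) (integrableOn_slice_update b j hG X), mul_add]

/-- The slot lift of `−F`. [folklore] -/
theorem slotLift_neg (F : Config N → ℂ) :
    slotLift L j a b (fun X => -F X) = fun X => -slotLift L j a b F X := by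
  funext X
  simp only [slotLift, mul_neg, integral_neg]

/-- The slot lift of `F − G` (continuous arguments). [folklore] -/
theorem slotLift_sub {F G : Config N → ℂ} (hF : Continuous F) (hG : Continuous G) :
    slotLift L j a b (fun X => F X - G X) = fun X => slotLift L j a b F X - slotLift L j a b G X := by
  simp only [sub_eq_add_neg]
  rw [slotLift_add (G := fun X => -G X) hF hG.neg, slotLift_neg]

/-- Homogeneity of the slot lift. [folklore] -/
theorem slotLift_const_mul (c : ℂ) (F : Config N → ℂ) :
    slotLift L j a b (fun X => c * F X) = fun X => c * slotLift L j a b F X := by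
  funext X
  simp only [slotLift]
  have : (fun y => conj (planeWaveMode L b y) * (c * F (Function.update X j y))) =
      fun y => c * (conj (planeWaveMode L b y) * F (Function.update X j y)) := by
    funext y; ring
  rw [this, integral_const_mul]
  ring

/-- The slot lift of a finite sum of continuous functions. [folklore] -/
theorem slotLift_finset_sum {ι : Type*} (s : Finset ι) {F : ι → Config N → ℂ} (hF : ∀ i ∈ s, Continuous (F i)) :
    slotLift L j a b (fun X => ∑ i ∈ s, F i X) = fun X => ∑ i ∈ s, slotLift L j a b (F i) X := by
  classical
  induction s using Finset.induction_on with
  | empty =>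
    funext X
    simp [slotLift]
  | @insert i s hi ih =>
    have hFi : Continuous (F i) := hF i (Finset.mem_insert_self i s)
    have hFs : ∀ i' ∈ s, Continuous (F i') := fun i' hi' => hF i' (Finset.mem_insert_of_mem hi')
    have hsum : Continuous fun X => ∑ i' ∈ s, F i' X := continuous_finsetSum s fun i' hi' => hFs i' hi'
    simp only [Finset.sum_insert hi]
    rw [slotLift_add hFi hsum, ih hFs]

end SlotLift

/-! ## Two slot lifts on different particles commute -/

section Commute

/-- **`[slotLift i, slotLift j] = 0` for `i ≠ j`** on continuous functions (the two cell integrals commute by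
Fubini; `X[i ↦ y][j ↦ z] = X[j ↦ z][i ↦ y]`). [folklore] -/
theorem slotLift_comm {i j : Fin N} (hij : i ≠ j) (a b c d : Fin 3 → ℤ) {F : Config N → ℂ} (hF : Continuous F) :
    slotLift L i a b (slotLift L j c d F) = slotLift L j c d (slotLift L i a b F) := by
  funext X
  simp only [slotLift_apply]
  simp only [Function.update_of_ne hij.symm, Function.update_of_ne hij, ← integral_const_mul]
  -- both sides are `φ_a(x_i) φ_c(x_j) ∬ conj φ_b(y) conj φ_d(z) F(X[i↦y][j↦z])`
  have hK : Continuous fun p : Space × Space => F (Function.update (Function.update X i p.1) j p.2) :=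
    hF.comp (((continuous_const : Continuous fun _ : Space × Space => X).update i continuous_fst).update j
      continuous_snd)
  have hint : Integrable (Function.uncurry fun (y z : Space) => planeWaveMode L a (X i) *
      (conj (planeWaveMode L b y) * (planeWaveMode L c (X j) *
        (conj (planeWaveMode L d z) * F (Function.update (Function.update X i y) j z)))))
      (((volume : Measure Space).restrict (cell L)).prod ((volume : Measure Space).restrict (cell L))) := by
    rw [Measure.prod_restrict]
    refine integrableOn_of_continuous_of_isBounded ((isBounded_cell L).prod (isBounded_cell L)) ?_
    exact continuous_const.mul (((Complex.continuous_conj.comp (continuous_planeWaveMode L b)).comp continuous_fst).mul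
      (continuous_const.mul (((Complex.continuous_conj.comp (continuous_planeWaveMode L d)).comp continuous_snd).mul hK)))
  rw [integral_integral_swap hint]
  refine integral_congr_ae (Eventually.of_forall fun z => ?_)
  refine integral_congr_ae (Eventually.of_forall fun y => ?_)
  simp only
  rw [Function.update_comm hij]
  ring

end Commute

/-! ## The one-body lift through the slots -/

section TransferSlots

/-- `y :: (X without j) = X[j ↦ y] ∘ (cycleRange j)⁻¹`: inserting at the front is updating slot `j` up to a
relabelling. [folklore] -/
theorem vecCons_removeNth_eq_update_comp (j : Fin (n + 1)) (X : Config (n + 1)) (y : Space) :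
    Matrix.vecCons y (j.removeNth X) = Function.update X j y ∘ j.cycleRange.symm := by
  rw [comp_cycleRange_symm_eq_vecCons, Function.update_self]
  congr 1
  ext i : 1
  simp only [Fin.removeNth]
  rw [Function.update_of_ne (Fin.succAbove_ne j i)]

/-- **The one-body lift through the slots**: `transfer L a b Ψ = ∑_j slotLift j a b Ψ` for a Bose-symmetric
`(n+1)`-body `Ψ` (`a†(φ_a)a(φ_b) = ∑_j |φ_a⟩⟨φ_b|_j`; the `√(n+1)` factors cancel). [folklore] -/
theorem transfer_eq_sum_slotLift (L : ℝ) (a b : Fin 3 → ℤ) {Ψ : Config (n + 1) → ℂ} (hΨ : IsSymm Ψ) :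
    transfer L a b Ψ = fun X => ∑ j : Fin (n + 1), slotLift L j a b Ψ X := by
  funext X
  change modeCr (planeWaveMode L a) (modeAn L (planeWaveMode L b) Ψ) X = _
  rw [modeCr_apply, Finset.mul_sum]
  refine Finset.sum_congr rfl fun j _ => ?_
  rw [modeAn_apply, slotLift_apply]
  have hslice : ∀ y, Ψ (Matrix.vecCons y (j.removeNth X)) = Ψ (Function.update X j y) := fun y => by
    rw [vecCons_removeNth_eq_update_comp, hΨ]
  simp only [hslice]
  have hc := sqrt_cast_ne_zero n
  field_simp

/-- `U_kΨ = liftOp univ k 0 0 (−k) Ψ` for a Bose-symmetric `(n+1)`-body `Ψ`. [folklore] -/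
theorem phaseUp_eq_liftOp (L : ℝ) (k : Fin 3 → ℤ) {Ψ : Config (n + 1) → ℂ} (hΨ : IsSymm Ψ) :
    phaseUp L k Ψ = liftOp L Finset.univ k 0 0 (-k) Ψ := by
  funext X
  change transfer L k 0 Ψ X - transfer L 0 (-k) Ψ X = _
  rw [transfer_eq_sum_slotLift L k 0 hΨ, transfer_eq_sum_slotLift L 0 (-k) hΨ, liftOp, Finset.sum_sub_distrib]

end TransferSlots

/-! ## The lift `liftOp`: continuity, linearity, splitting, commutation -/

section LiftOp

variable {S : Finset (Fin N)} {a b c d : Fin 3 → ℤ}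

/-- `liftOp S a b c d F` is continuous for continuous `F`. [folklore] -/
theorem continuous_liftOp (L : ℝ) (S : Finset (Fin N)) (a b c d : Fin 3 → ℤ) {F : Config N → ℂ} (hF : Continuous F) :
    Continuous (liftOp L S a b c d F) := by
  unfold liftOp
  exact continuous_finsetSum S fun j _ => (continuous_slotLift L j a b hF).sub (continuous_slotLift L j c d hF)

/-- Additivity of `liftOp` (continuous arguments). [folklore] -/
theorem liftOp_add {F G : Config N → ℂ} (hF : Continuous F) (hG : Continuous G) :
    liftOp L S a b c d (fun X => F X + G X) = fun X => liftOp L S a b c d F X + liftOp L S a b c d G X := by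
  funext X
  simp only [liftOp, slotLift_add hF hG, ← Finset.sum_add_distrib]
  exact Finset.sum_congr rfl fun j _ => by ring

/-- `liftOp` of `F − G` (continuous arguments). [folklore] -/
theorem liftOp_sub {F G : Config N → ℂ} (hF : Continuous F) (hG : Continuous G) :
    liftOp L S a b c d (fun X => F X - G X) = fun X => liftOp L S a b c d F X - liftOp L S a b c d G X := by
  funext X
  simp only [liftOp, slotLift_sub hF hG, ← Finset.sum_sub_distrib]
  exact Finset.sum_congr rfl fun j _ => by ring

/-- Splitting the particles: `liftOp (S ∪ T) = liftOp S + liftOp T` for disjoint `S, T`. [folklore] -/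
theorem liftOp_union {T : Finset (Fin N)} (hST : Disjoint S T) (F : Config N → ℂ) :
    liftOp L (S ∪ T) a b c d F = fun X => liftOp L S a b c d F X + liftOp L T a b c d F X := by
  funext X
  simp only [liftOp, Finset.sum_union hST]

/-- A slot lift commutes with the lift to particles avoiding its slot (continuous argument). [folklore] -/
theorem slotLift_liftOp_comm {i : Fin N} {U : Finset (Fin N)} (hiU : i ∉ U) (e f p q r s : Fin 3 → ℤ)
    {F : Config N → ℂ} (hF : Continuous F) :
    slotLift L i e f (liftOp L U p q r s F) = liftOp L U p q r s (slotLift L i e f F) := by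
  have hterm : ∀ j ∈ U, Continuous fun X => slotLift L j p q F X - slotLift L j r s F X := fun j _ =>
    (continuous_slotLift L j p q hF).sub (continuous_slotLift L j r s hF)
  change slotLift L i e f (fun X => ∑ j ∈ U, (slotLift L j p q F X - slotLift L j r s F X)) = _
  rw [slotLift_finset_sum U hterm]
  funext X
  unfold liftOp
  refine Finset.sum_congr rfl fun j hj => ?_
  have hij : i ≠ j := fun h => hiU (h ▸ hj)
  change slotLift L i e f (fun X => slotLift L j p q F X - slotLift L j r s F X) X = _
  rw [slotLift_sub (continuous_slotLift L j p q hF) (continuous_slotLift L j r s hF)]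
  simp only
  rw [slotLift_comm hij e f p q hF, slotLift_comm hij e f r s hF]

/-- **Lifts to disjoint sets of particles commute**: `liftOp S ∘ liftOp T = liftOp T ∘ liftOp S` for disjoint
`S, T` (continuous argument). [folklore] -/
theorem liftOp_comm {T : Finset (Fin N)} (hST : Disjoint S T) (a b c d a' b' c' d' : Fin 3 → ℤ)
    {F : Config N → ℂ} (hF : Continuous F) :
    liftOp L S a b c d (liftOp L T a' b' c' d' F) = liftOp L T a' b' c' d' (liftOp L S a b c d F) := by
  have hS : ∀ i ∈ S, i ∉ T := fun i hi hiT => Finset.disjoint_left.1 hST hi hiT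
  have hT : ∀ j ∈ T, j ∉ S := fun j hj hjS => Finset.disjoint_left.1 hST hjS hj
  funext X
  -- push the outer slot lifts inside
  have hL : liftOp L S a b c d (liftOp L T a' b' c' d' F) X =
      ∑ i ∈ S, ∑ j ∈ T, ((slotLift L j a' b' (slotLift L i a b F) X - slotLift L j c' d' (slotLift L i a b F) X) -
        (slotLift L j a' b' (slotLift L i c d F) X - slotLift L j c' d' (slotLift L i c d F) X)) := by
    conv_lhs => rw [liftOp]
    refine Finset.sum_congr rfl fun i hi => ?_
    rw [slotLift_liftOp_comm (hS i hi) a b a' b' c' d' hF, slotLift_liftOp_comm (hS i hi) c d a' b' c' d' hF,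
      liftOp, liftOp, ← Finset.sum_sub_distrib]
  have hR : liftOp L T a' b' c' d' (liftOp L S a b c d F) X =
      ∑ j ∈ T, ∑ i ∈ S, ((slotLift L i a b (slotLift L j a' b' F) X - slotLift L i c d (slotLift L j a' b' F) X) -
        (slotLift L i a b (slotLift L j c' d' F) X - slotLift L i c d (slotLift L j c' d' F) X)) := by
    conv_lhs => rw [liftOp]
    refine Finset.sum_congr rfl fun j hj => ?_
    rw [slotLift_liftOp_comm (hT j hj) a' b' a b c d hF, slotLift_liftOp_comm (hT j hj) c' d' a b c d hF,
      liftOp, liftOp, ← Finset.sum_sub_distrib]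
  rw [hL, hR, Finset.sum_comm]
  refine Finset.sum_congr rfl fun j hj => Finset.sum_congr rfl fun i hi => ?_
  have hij : i ≠ j := fun h => hS i hi (h ▸ hj)
  rw [slotLift_comm hij a b a' b' hF, slotLift_comm hij a b c' d' hF, slotLift_comm hij c d a' b' hF,
    slotLift_comm hij c d c' d' hF]
  ring

end LiftOp

/-! ## Registered headline -/

/-- **Registered by-product sub-goal `stub_fsumDCPotSlot`** (line `fsum-phase-pencil`, helper of S3
`stub_phaseDoubleCommutator`): the one-body lift through the slots, `transfer_eq_sum_slotLift`. [folklore] -/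
theorem stub_fsumDCPotSlot : ∀ {n : ℕ} (L : ℝ) (a b : Fin 3 → ℤ) {Ψ : Config (n + 1) → ℂ}, IsSymm Ψ → transfer L a b Ψ = fun X => ∑ j : Fin (n + 1), slotLift L j a b Ψ X :=
  fun L a b _ hΨ => transfer_eq_sum_slotLift L a b hΨ

end Summit.AtomisticToContinuum.BoseEinsteinCondensation.Cruxes.PeriodicIRBound.FsumPhasePencil

end
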